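import Summits.QuantumFields.YangMills.Theorems.BalabanUVNodesClustersCore
import Literature.MathematicalPhysics.QuantumFieldTheory.Balaban1983to89.Node00.N01Dossier
import Literature.MathematicalPhysics.QuantumFieldTheory.Balaban1983to89.Node00.Record8Inhabited

/-!
# BalabanUVNodes ∕ N01 — the K1 stub `S_N01 Rec := AtRecord Rec Dag.B4_main` of the landed cluster file
# (`Theorems/BalabanUVNodesClustersCore.lean`) BY NAME, at every record predicate NODE 00 has landed (Track A, DAG node N01 of 28; count-neutral)

HONEST FRAMING.  Count-neutral kernel bookkeeping; NOT a node discharge and not an estimate.  N01 = [Balaban1983RegularityDecay]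
(Theorem (1.9)–(1.12) p. 573 in its `0 ≤ α < 1` form, «Prop. 2.3 of [1]» p. 574, «Prop. 3.1′ of [2]» p. 574, Sect. 5 Theorem p. 594)
IS DISCHARGED OF RECORD (pub-ymgap chair R444, 2026-08-26) by node00-def's `Node00.b4_main_of_isWorldOfRecord₁` (`Node00/Carriers.lean`,
dossier alias `Node00.N01_at_record`, `Node00/N01Dossier.lean`) and the referees' reads — unchanged and not restated here.  THIS module
only writes the route's K1 stub `YMDAG.UVSplit.S_N01 Rec` («`Dag.B4_main` at every run of every world of record», the record predicate
`Rec : RecordPred N` a PARAMETER) as a theorem for every `Rec` that refines one of NODE 00's landed record predicates, so that the day route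
«BalabanUVNodes» files `stub_N01` its closing term is ONE NAME from here at whatever terminal stage the route's ONE WRITER restates `Rec`.
Every proof is a one-liner over landed theorems; `N` and `Rec` are parameters; no satisfiability of any predicate is asserted except where a
landed inhabitation theorem is cited by name (§4).  One finite four-torus programme at fixed `ε` per run; nothing continuum ∕ ℝ⁴ ∕ OS ∕
mass-gap ∕ Clay.  0 `def`, 0 `sorry`, standard axioms.

WHAT IS PROVED.
* §1 GENERIC.  `S_N01 Rec` is literally «the leaf `b4` at every run of every `Rec`-world» (`s_N01_iff`, `Iff.rfl`: N01 is a SOURCE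
  node, there is no in-edge to consume — vacuity guard in kernel form); it is ANTITONE in `Rec` (`s_N01_antitone`); and it holds for
  every `Rec` refining Stage 1 (`s_N01_of_refines₁`, by the discharge theorem of record `N01_at_record`) and — the REFINEMENT-GENERIC
  closers — for every `Rec` refining `IsRecordOfRecord₅` ∕ `₅C` ∕ `₇C` ∕ `₈C` (`s_N01_of_refines₅∕₅C∕₇C∕₈C`: one application of node00-def's
  refinement lemma closes any later stage ₉, …).
* §2 AT NODE 00's predicates: the Stage-1 instance `s_N01_rec₁` (the count's stage, R444) and its one-level side twin `s_N01_rec₁OL`; the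
  Stage-7 ∕ 8 FOLDS `b4_main_of_isRecordOfRecord₇C∕₈C` (node00-def: «yours to fold»); the closers of record BY NAME `s_N01_rec₅C ∕ ₇C ∕ ₈C`
  (plan's word (W2), 2026-08-26: per-node closers at the record predicates are owned by the node's own AT-RECORD module; the courier's staged
  modules 3∕7∕8∕10 are re-cut to cite these).  No Stage-2∕3 face is stated (node00-def's `b4_main_of_isWorldOfRecord₂∕₃` ARE those faces).
* §3 THE K1 CLUSTER «KnitIR».  `FrameIR D w` from its five non-N01 fields given `S_N01 Rec` (`frameIR_of_s_N01`); conversely `KnitIR Rec`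
  yields `S_N01 Rec` (`s_N01_of_knitIR`); **`knitIR_iff_stubs : KnitIR Rec ↔ S_W00 ∧ S_N01 ∧ S_N02 ∧ S_N23`** (converse of the landed join
  `KnitIR_of`); `KnitIR Rec ↔` «KnitIR with the `b4` field dropped» given `S_N01 Rec` (`knitIR_iff_of_s_N01`).
  At a record refining `₅C` the fields `construction`, `gamma_pos`, `datum₀` (N23, R439), `b5` (N02, R438) and `b4` (N01, R444) are ALL
  landed theorems of node00-def's record modules, so BY NAME `KnitIR Rec ↔ (inhabitation) ∧ (the RG-flow leaf (0.20) at EVERY run)`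
  (`knitIR_iff_rgFlow_of_refines₅C`; `knitIR_iff_S_W00_of_refines₅C : KnitIR Rec ↔ S_W00 Rec`; N-bound twin `knitIR_iff_rgFlow_of_refines₅`);
  at `₇C` ∕ `₈C` inhabitation is n23-b's theorem, leaving EXACTLY W00's unguarded (0.20) clause
  (`knitIR₇C_iff_rgFlow`, `knitIR₈C_iff_rgFlow`; the record supplies the GUARDED form `Node00.rgFlow_of_smallCouplings_of_isRecordOfRecord₅C`
  — runs inside the window — which is why K1 is not asserted closed here).
* §4 NON-VACUITY (A1): the `₇C` ∕ `₈C` predicates are INHABITED for every family (`Record8Inhabited.exists_isRecordOfRecord₇C∕₈C`), so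
  N01 there is not true-by-empty-antecedent (`inhabited₇C∕₈C_and_b4_main`); at Stage-1 worlds the B4 families themselves are
  non-degenerate by `Node00.N01_at_record_nonvacuous` (not restated).
ZERO-CHART SENTENCE (chair R445 (A), ZEROCHART rider v0.33; dag-lead WORDS-40 hygiene).  Every `₇C` ∕ `₈C` statement of §§2–4 is in ∀-FORM over
ALL records `IsRecordOfRecord₇C∕₈C F N D w` — hence over every admissible `θ : Stage8Params`, degenerate charts included — and N01's leaf `b4`
does not read the β-chart `(Vβ, ρ8, bV, v₀)` at all.  The ONLY ∃ used here is n23-b's inhabitation theorem, whose witness IS the DEGENERATE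
zero-chart record (`exists_admissible_stage8Params_zeroChart`, «not an object of record»): it is cited for the A1 guard «the antecedent is
satisfiable» and for nothing else; no ∃-form claim over the ₈C predicate is made or counted.
-/

namespace Summit.QuantumFields.YangMills.BalabanUVNodes.N01AtRecord

open Literature.MathematicalPhysics.QuantumFieldTheory.Balaban1983to89
open Literature.MathematicalPhysics.QuantumFieldTheory.Balaban1983to89.Node00
open Literature.MathematicalPhysics.QuantumFieldTheory.Balaban1983to89.Node00.Record8Inhabited (exists_isRecordOfRecord₇C
  exists_isRecordOfRecord₈C)
open Literature.MathematicalPhysics.QuantumFieldTheory.Balaban1983to89.T4Continuum (T4Family FiniteEpsData)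
open Literature.MathematicalPhysics.QuantumFieldTheory.Balaban1983to89.DagBinding (WorldP leavesP)
open YMDAG.UVSplit (RecordPred Datum AtRecord S_N01 FrameIR KnitIR)

variable {N : ℕ} [NeZero N]

/-! ## §1 Generic: the stub is the leaf `b4` at the record; antitone; from Stage 1 ∕ the ₅C record -/

/-- `S_N01 Rec` IS «the leaf `b4` holds at every run of every `Rec`-world»: N01 is a SOURCE node (`Dag.B4_main ℓ := ℓ.b4`), so the stub
consumes no in-edge and has no ex-falso reading. [cite: Balaban1983RegularityDecay, Theorem p.573 (node statement; bookkeeping)] -/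
theorem s_N01_iff (Rec : RecordPred N) :
    S_N01 Rec ↔ ∀ (F : T4Family) (D : Datum F N) (w : WorldP), Rec F D w → ∀ P : B12.RunParams, (leavesP w P).b4 :=
  Iff.rfl

/-- The stub is ANTITONE in the record predicate: a finer predicate inherits it. [cite: Balaban1983RegularityDecay, Theorem p.573 (bookkeeping)] -/
theorem s_N01_antitone {Rec Rec' : RecordPred N}
    (hle : ∀ (F : T4Family) (D : Datum F N) (w : WorldP), Rec' F D w → Rec F D w) (h : S_N01 Rec) : S_N01 Rec' :=
  fun F D w hw P => h F D w (hle F D w hw) P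

/-- `S_N01 Rec` for every `Rec` refining NODE 00's Stage-1 world predicate — the discharge theorem of record `Node00.N01_at_record`
(= `b4_main_of_isWorldOfRecord₁`) BY NAME. [cite: Balaban1983RegularityDecay, Theorem p.573, Prop. 2.3 ∕ Prop. 3.1′ p.574, Sect. 5 Theorem p.594] -/
theorem s_N01_of_refines₁ {Rec : RecordPred N}
    (hRec : ∀ (F : T4Family) (D : Datum F N) (w : WorldP), Rec F D w → IsWorldOfRecord₁ w) : S_N01 Rec :=
  fun F D w hw P => N01_at_record w (hRec F D w hw) P

/-- `S_N01 Rec` for every `Rec` refining the C-bound Stage-5 record predicate `IsRecordOfRecord₅C` (`Node00.b4_main_of_isRecordOfRecord₅C`: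
the `b4` leaf of the (C) binding is the N-binding's). [cite: Balaban1983RegularityDecay, Theorem p.573 (bookkeeping)] -/
theorem s_N01_of_refines₅C {Rec : RecordPred N}
    (hRec : ∀ (F : T4Family) (D : Datum F N) (w : WorldP), Rec F D w → IsRecordOfRecord₅C F N D w) : S_N01 Rec :=
  fun F D w hw P => b4_main_of_isRecordOfRecord₅C (hRec F D w hw) P

/-! ## §2 At NODE 00's landed predicates: the Stage-1 instance (the count's stage), the Stage-7 ∕ 8 folds, the refinement closers -/

/-- N01's stub at the Stage-1 world predicate (datum-blind). [cite: Balaban1983RegularityDecay, Theorem p.573 (bookkeeping)] -/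
theorem s_N01_rec₁ : S_N01 (fun (F : T4Family) (_ : Datum F N) (w : WorldP) => IsWorldOfRecord₁ w) :=
  s_N01_of_refines₁ fun _ _ _ hw => hw

/-- N01's stub at the one-level Stage-1 side predicate `IsWorldOfRecord₁OL` (dossier `N01_at_record₁OL`). [cite: Balaban1983RegularityDecay, Theorem p.573 (bookkeeping)] -/
theorem s_N01_rec₁OL : S_N01 (fun (F : T4Family) (_ : Datum F N) (w : WorldP) => IsWorldOfRecord₁OL w) :=
  fun _ _ w hw P => N01_at_record₁OL w hw P

/-- **N01 at a Stage-7 record, folded by name** (node00-def's refinement edge `isRecordOfRecord₅C_of_isRecordOfRecord₇C` ∘ `b4_main_of_isRecordOfRecord₅C`):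
`Dag.B4_main` at every run. [cite: Balaban1983RegularityDecay, Theorem p.573 (bookkeeping)] -/
theorem b4_main_of_isRecordOfRecord₇C {F : T4Family} {D : Datum F N} {w : WorldP} (h : IsRecordOfRecord₇C F N D w) (P : B12.RunParams) :
    Dag.B4_main (leavesP w P) :=
  b4_main_of_isRecordOfRecord₅C (isRecordOfRecord₅C_of_isRecordOfRecord₇C h) P

/-- **N01 at a Stage-8 record, folded by name** (`isRecordOfRecord₅C_of_isRecordOfRecord₈C` ∘ `b4_main_of_isRecordOfRecord₅C`): `Dag.B4_main` at every run of
EVERY Stage-8 record (∀-form; the leaf `b4` does not read the β-chart). [cite: Balaban1983RegularityDecay, Theorem p.573 (bookkeeping)] -/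
theorem b4_main_of_isRecordOfRecord₈C {F : T4Family} {D : Datum F N} {w : WorldP} (h : IsRecordOfRecord₈C F N D w) (P : B12.RunParams) :
    Dag.B4_main (leavesP w P) :=
  b4_main_of_isRecordOfRecord₅C (isRecordOfRecord₅C_of_isRecordOfRecord₈C h) P

/-- N01's stub AT the C-bound Stage-5 record predicate itself (closer of record by name under plan's (W2)). [cite: Balaban1983RegularityDecay, Theorem p.573 (bookkeeping)] -/
theorem s_N01_rec₅C : S_N01 (fun (F : T4Family) (D : Datum F N) (w : WorldP) => IsRecordOfRecord₅C F N D w) :=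
  s_N01_of_refines₅C fun _ _ _ h => h

/-- N01's stub AT the Stage-7 record predicate. [cite: Balaban1983RegularityDecay, Theorem p.573 (bookkeeping)] -/
theorem s_N01_rec₇C : S_N01 (fun (F : T4Family) (D : Datum F N) (w : WorldP) => IsRecordOfRecord₇C F N D w) :=
  fun _ _ _ h P => b4_main_of_isRecordOfRecord₇C h P

/-- N01's stub AT the Stage-8 record predicate (∀-form over every Stage-8 record; the leaf `b4` does not read the β-chart).
[cite: Balaban1983RegularityDecay, Theorem p.573 (bookkeeping)] -/
theorem s_N01_rec₈C : S_N01 (fun (F : T4Family) (D : Datum F N) (w : WorldP) => IsRecordOfRecord₈C F N D w) :=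
  fun _ _ _ h P => b4_main_of_isRecordOfRecord₈C h P

/-- The stub for every `Rec` refining the Stage-7 ∕ Stage-8 records is ONE application of `s_N01_of_refines₅C` to node00-def's refinement lemma —
recorded here for ₇C as the pattern (₈C, ₉, … identical). [cite: Balaban1983RegularityDecay, Theorem p.573 (bookkeeping)] -/
theorem s_N01_of_refines₇C {Rec : RecordPred N}
    (hRec : ∀ (F : T4Family) (D : Datum F N) (w : WorldP), Rec F D w → IsRecordOfRecord₇C F N D w) : S_N01 Rec :=
  s_N01_of_refines₅C fun F D w hw => isRecordOfRecord₅C_of_isRecordOfRecord₇C (hRec F D w hw)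

/-- Idem for every `Rec` refining the Stage-8 record. [cite: Balaban1983RegularityDecay, Theorem p.573 (bookkeeping)] -/
theorem s_N01_of_refines₈C {Rec : RecordPred N}
    (hRec : ∀ (F : T4Family) (D : Datum F N) (w : WorldP), Rec F D w → IsRecordOfRecord₈C F N D w) : S_N01 Rec :=
  s_N01_of_refines₅C fun F D w hw => isRecordOfRecord₅C_of_isRecordOfRecord₈C (hRec F D w hw)

/-! ## §3 The K1 cluster «KnitIR» with its N01 field supplied by name -/

/-- The K1 frame at `(D, w)` from its five NON-N01 fields, the `b4` field supplied by `S_N01 Rec`. [cite: Balaban1983RegularityDecay, Theorem p.573 (bookkeeping)] -/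
theorem frameIR_of_s_N01 {Rec : RecordPred N} (h₁ : S_N01 Rec) {F : T4Family} {D : Datum F N} {w : WorldP} (hw : Rec F D w)
    (hC : w.C = D.C) (hγ : 0 < w.γ) (hrg : ∀ P : B12.RunParams, (leavesP w P).rgFlow) (hd : IsDatumOfRecord₀ F N D)
    (hb5 : ∀ P : B12.RunParams, Dag.B5_main (leavesP w P)) : FrameIR D w :=
  ⟨hC, hγ, hrg, hd, h₁ F D w hw, hb5⟩

/-- Conversely the K1 cluster carries N01's stub as its `b4` field. [cite: Balaban1983RegularityDecay, Theorem p.573 (bookkeeping)] -/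
theorem s_N01_of_knitIR {Rec : RecordPred N} (hK : KnitIR Rec) : S_N01 Rec :=
  fun F D w hw P => (hK.2 F D w hw).b4 P

/-- **K1 IS EXACTLY ITS FOUR STUBS** — the converse of the landed join `YMDAG.UVSplit.KnitIR_of` (`BalabanUVNodesClusters`): `KnitIR Rec ↔ S_W00 ∧ S_N01 ∧
S_N02 ∧ S_N23` at `Rec`. [cite: Balaban1987RG1, (0.20) p.256; Balaban1983RegularityDecay, Theorem p.573 (bookkeeping)] -/
theorem knitIR_iff_stubs (Rec : RecordPred N) :
    KnitIR Rec ↔ YMDAG.UVSplit.S_W00 Rec ∧ S_N01 Rec ∧ YMDAG.UVSplit.S_N02 Rec ∧ YMDAG.UVSplit.S_N23 Rec := by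
  constructor
  · rintro ⟨hex, hfr⟩
    exact ⟨⟨hex, fun F D w hw => ⟨(hfr F D w hw).construction, (hfr F D w hw).gamma_pos, (hfr F D w hw).rg⟩⟩,
      fun F D w hw P => (hfr F D w hw).b4 P, fun F D w hw P => (hfr F D w hw).b5 P, fun F D w hw => (hfr F D w hw).datum₀⟩
  · rintro ⟨⟨hex, hW⟩, h1, h2, h23⟩
    refine ⟨hex, fun F D w hw => ?_⟩
    obtain ⟨hC, hγ, hrg⟩ := hW F D w hw
    exact ⟨hC, hγ, hrg, h23 F D w hw, h1 F D w hw, h2 F D w hw⟩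

/-- **K1 with the N01 field dropped.**  Given `S_N01 Rec`, `KnitIR Rec` is equivalent to: inhabitation ∧ at every record the four remaining
frame fields (construction, window, the RG-flow leaf at every run, the Stage-0 datum clause) ∧ N02. [cite: Balaban1983RegularityDecay, Theorem p.573 (bookkeeping)] -/
theorem knitIR_iff_of_s_N01 {Rec : RecordPred N} (h₁ : S_N01 Rec) :
    KnitIR Rec ↔
      (∀ F : T4Family, ∃ (D : Datum F N) (w : WorldP), Rec F D w) ∧
        ∀ (F : T4Family) (D : Datum F N) (w : WorldP), Rec F D w →
          w.C = D.C ∧ 0 < w.γ ∧ (∀ P : B12.RunParams, (leavesP w P).rgFlow) ∧ IsDatumOfRecord₀ F N D ∧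
            ∀ P : B12.RunParams, Dag.B5_main (leavesP w P) := by
  constructor
  · rintro ⟨hex, hfr⟩
    exact ⟨hex, fun F D w hw =>
      ⟨(hfr F D w hw).construction, (hfr F D w hw).gamma_pos, (hfr F D w hw).rg, (hfr F D w hw).datum₀, (hfr F D w hw).b5⟩⟩
  · rintro ⟨hex, h⟩
    refine ⟨hex, fun F D w hw => ?_⟩
    obtain ⟨hC, hγ, hrg, hd, hb5⟩ := h F D w hw
    exact frameIR_of_s_N01 h₁ hw hC hγ hrg hd hb5

/-- **K1 at a record refining `₅C`, BY NAME.**  There `construction` ∕ `gamma_pos` (`Node00.construction_eq_of_isRecordOfRecord₅C` ∕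
`gamma_pos_of_isRecordOfRecord₅C`), the Stage-0 datum clause (N23: `isDatumOfRecord₀_of_isRecordOfRecord₅C`), N02 (`b5_main_of_isRecordOfRecord₅C`)
and N01 (`b4_main_of_isRecordOfRecord₅C`) are landed theorems, so `KnitIR Rec` is EXACTLY inhabitation ∧ the RG-flow leaf (0.20) at every run
(W00's third clause; the record itself supplies only the guarded form `rgFlow_of_smallCouplings_of_isRecordOfRecord₅C`).
[cite: Balaban1987RG1, (0.20) p.256; Balaban1983RegularityDecay, Theorem p.573 (bookkeeping)] -/
theorem knitIR_iff_rgFlow_of_refines₅C {Rec : RecordPred N}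
    (hRec : ∀ (F : T4Family) (D : Datum F N) (w : WorldP), Rec F D w → IsRecordOfRecord₅C F N D w) :
    KnitIR Rec ↔
      (∀ F : T4Family, ∃ (D : Datum F N) (w : WorldP), Rec F D w) ∧ AtRecord Rec fun ℓ => ℓ.rgFlow := by
  rw [knitIR_iff_of_s_N01 (s_N01_of_refines₅C hRec)]
  refine and_congr_right fun _ => forall₃_congr fun F D w => imp_congr_right fun hw => ?_
  have h := hRec F D w hw
  exact ⟨fun hf => hf.2.2.1, fun hrg =>
    ⟨construction_eq_of_isRecordOfRecord₅C h, gamma_pos_of_isRecordOfRecord₅C h, hrg, isDatumOfRecord₀_of_isRecordOfRecord₅C h,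
      fun P => b5_main_of_isRecordOfRecord₅C h P⟩⟩

/-- **K1 at a record refining `₅C` IS W00's STUB.**  With N01 ∕ N02 ∕ N23 theorems there, `KnitIR Rec ↔ S_W00 Rec` (and `S_W00 Rec` itself is
inhabitation ∧ the unguarded (0.20) at every run, its `w.C = D.C` ∕ `0 < w.γ` clauses being record theorems).
[cite: Balaban1987RG1, (0.20) p.256 (bookkeeping)] -/
theorem knitIR_iff_S_W00_of_refines₅C {Rec : RecordPred N}
    (hRec : ∀ (F : T4Family) (D : Datum F N) (w : WorldP), Rec F D w → IsRecordOfRecord₅C F N D w) :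
    KnitIR Rec ↔ YMDAG.UVSplit.S_W00 Rec := by
  rw [knitIR_iff_stubs]
  exact ⟨fun h => h.1, fun hW =>
    ⟨hW, s_N01_of_refines₅C hRec, fun F D w hw P => b5_main_of_isRecordOfRecord₅C (hRec F D w hw) P,
      fun F D w hw => isDatumOfRecord₀_of_isRecordOfRecord₅C (hRec F D w hw)⟩⟩

/-- `S_N01 Rec` for every `Rec` refining the N-bound Stage-5 record predicate `IsRecordOfRecord₅` (`Node00.b4_main_of_isRecordOfRecord₅`, through Stage 3).
[cite: Balaban1983RegularityDecay, Theorem p.573 (bookkeeping)] -/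
theorem s_N01_of_refines₅ {Rec : RecordPred N}
    (hRec : ∀ (F : T4Family) (D : Datum F N) (w : WorldP), Rec F D w → IsRecordOfRecord₅ F N D w) : S_N01 Rec :=
  fun F D w hw P => b4_main_of_isRecordOfRecord₅ (hRec F D w hw) P

/-- **K1 at a record refining the N-bound `₅` predicate, BY NAME** — the same reduction as `knitIR_iff_rgFlow_of_refines₅C` through
`Node00.construction_eq_∕gamma_pos_∕isDatumOfRecord₀_∕b5_main_∕b4_main_of_isRecordOfRecord₅`: `KnitIR Rec` IS inhabitation ∧ the RG-flow
leaf (0.20) at every run. [cite: Balaban1987RG1, (0.20) p.256; Balaban1983RegularityDecay, Theorem p.573 (bookkeeping)] -/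
theorem knitIR_iff_rgFlow_of_refines₅ {Rec : RecordPred N}
    (hRec : ∀ (F : T4Family) (D : Datum F N) (w : WorldP), Rec F D w → IsRecordOfRecord₅ F N D w) :
    KnitIR Rec ↔
      (∀ F : T4Family, ∃ (D : Datum F N) (w : WorldP), Rec F D w) ∧ AtRecord Rec fun ℓ => ℓ.rgFlow := by
  rw [knitIR_iff_of_s_N01 (s_N01_of_refines₅ hRec)]
  refine and_congr_right fun _ => forall₃_congr fun F D w => imp_congr_right fun hw => ?_
  have h := hRec F D w hw
  exact ⟨fun hf => hf.2.2.1, fun hrg =>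
    ⟨construction_eq_of_isRecordOfRecord₅ h, gamma_pos_of_isRecordOfRecord₅ h, hrg, isDatumOfRecord₀_of_isRecordOfRecord₅ h,
      fun P => b5_main_of_isRecordOfRecord₅ h P⟩⟩

/-- **K1 at NODE 00's Stage-7 record**: inhabitation is n23-b's theorem (`Record8Inhabited.exists_isRecordOfRecord₇C`; zero-chart collapse:
its witness is the DEGENERATE zero-chart record, used for the inhabitation conjunct only), so `KnitIR` there IS the unguarded RG-flow leaf (0.20)
at every run of EVERY record world (∀-form, every admissible θ) — nothing else. [cite: Balaban1987RG1, (0.20) p.256 (bookkeeping)] -/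
theorem knitIR₇C_iff_rgFlow :
    KnitIR (fun (F : T4Family) (D : Datum F N) (w : WorldP) => IsRecordOfRecord₇C F N D w) ↔
      AtRecord (fun (F : T4Family) (D : Datum F N) (w : WorldP) => IsRecordOfRecord₇C F N D w) fun ℓ => ℓ.rgFlow := by
  rw [knitIR_iff_rgFlow_of_refines₅C fun _ _ _ h => isRecordOfRecord₅C_of_isRecordOfRecord₇C h]
  exact and_iff_right fun F => exists_isRecordOfRecord₇C F N

/-- **K1 at NODE 00's Stage-8 record**: inhabitation is n23-b's theorem (`Record8Inhabited.exists_isRecordOfRecord₈C`; zero-chart collapse: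
its witness is the DEGENERATE zero-chart record, used for the inhabitation conjunct only), so `KnitIR` there IS the unguarded RG-flow leaf (0.20)
at every run of EVERY record world (∀-form, every admissible θ) — nothing else. [cite: Balaban1987RG1, (0.20) p.256 (bookkeeping)] -/
theorem knitIR₈C_iff_rgFlow :
    KnitIR (fun (F : T4Family) (D : Datum F N) (w : WorldP) => IsRecordOfRecord₈C F N D w) ↔
      AtRecord (fun (F : T4Family) (D : Datum F N) (w : WorldP) => IsRecordOfRecord₈C F N D w) fun ℓ => ℓ.rgFlow := by
  rw [knitIR_iff_rgFlow_of_refines₅C fun _ _ _ h => isRecordOfRecord₅C_of_isRecordOfRecord₈C h]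
  exact and_iff_right fun F => exists_isRecordOfRecord₈C F N

/-- The guarded half the record DOES supply at `₈C`: along every run whose couplings stay inside the world's window the RG-flow leaf holds
(`Node00.rgFlow_of_smallCouplings_of_isRecordOfRecord₅C` through the refinement). [cite: Balaban1987RG1, (0.20) p.256] -/
theorem rgFlow_of_smallCouplings_stage₈C {F : T4Family} {D : Datum F N} {w : WorldP} (h : IsRecordOfRecord₈C F N D w)
    (P : B12.RunParams) (hsc : (leavesP w P).smallCouplings) : (leavesP w P).rgFlow :=
  rgFlow_of_smallCouplings_of_isRecordOfRecord₅C (isRecordOfRecord₅C_of_isRecordOfRecord₈C h) P hsc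

/-! ## §4 Non-vacuity (A1): the stub at ₇C ∕ ₈C is not true-by-empty-antecedent -/

/-- **INHABITED-AT-₇C ∧ N01 there**: for every family a Stage-7 record exists (n23-b; zero-chart collapse: DEGENERATE witness, A1 only)
and at EVERY Stage-7 record `Dag.B4_main` holds at every run (∀-form).
[cite: Balaban1983RegularityDecay, Theorem p.573 (bookkeeping; non-vacuity by the landed inhabitation theorem)] -/
theorem inhabited₇C_and_b4_main :
    (∀ F : T4Family, ∃ (D : Datum F N) (w : WorldP), IsRecordOfRecord₇C F N D w) ∧
      ∀ (F : T4Family) (D : Datum F N) (w : WorldP), IsRecordOfRecord₇C F N D w → ∀ P : B12.RunParams, Dag.B4_main (leavesP w P) :=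
  ⟨fun F => exists_isRecordOfRecord₇C F N, fun _ _ _ h P => b4_main_of_isRecordOfRecord₇C h P⟩

/-- **INHABITED-AT-₈C ∧ N01 there**: for every family a Stage-8 record exists (n23-b; zero-chart collapse: the witness is the DEGENERATE
zero-chart record — A1 «antecedent satisfiable» only, not an object of record) and at EVERY Stage-8 record `Dag.B4_main` holds at every run
(∀-form). (At Stage-1 worlds the B4 families are moreover non-degenerate below every threshold: `Node00.N01_at_record_nonvacuous`.)
[cite: Balaban1983RegularityDecay, Theorem p.573 (bookkeeping; non-vacuity by the landed inhabitation theorem)] -/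
theorem inhabited₈C_and_b4_main :
    (∀ F : T4Family, ∃ (D : Datum F N) (w : WorldP), IsRecordOfRecord₈C F N D w) ∧
      ∀ (F : T4Family) (D : Datum F N) (w : WorldP), IsRecordOfRecord₈C F N D w → ∀ P : B12.RunParams, Dag.B4_main (leavesP w P) :=
  ⟨fun F => exists_isRecordOfRecord₈C F N, fun _ _ _ h P => b4_main_of_isRecordOfRecord₈C h P⟩

end Summit.QuantumFields.YangMills.BalabanUVNodes.N01AtRecord
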